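import Mathlib
import HarnessLib

/-!
# The subgroup heat bath (Cabibbo–Marinari hit) on a group with invariant measure is reversible

HONEST FRAMING: exact (Metropolis-corrected) sampling algorithms for lattice gauge theory;
figures of merit are autocorrelation/cost numbers at stated couplings and volumes; no
continuum-physics claim.

Venture `LatticeQCDFlow` (cell pub-lqcd), topic `Exactness`, FANOUT row 9 (eng-latcore; the
engine's `updates.sweep(f, β, 'hb' | 'or')` for `SU(N)`, `N ≥ 3`: Cabibbo–Marinari SU(2)-subgroup
hits, `csrc/latcore_template.c`).  NEW WORK of the cell over Mathlib's kernel and Haar-measure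
libraries (`Kernel.withDensity`, `lintegral_mul_left_eq_self`, `lintegral_mul_right_eq_self`,
`lintegral_inv_eq_self`, Tonelli); nothing is cited as a fact.  Printed counterparts, named only:
Cabibbo–Marinari 1982; the "random subgroup Gibbs step".

`PartitionHeatBath.lean` types the subgroup heat bath for FINITE groups and `FibreLift.lean` the
coordinate heat bath on product spaces `X × Y`.  The engine's SU(N) heat bath is neither: it
left-multiplies the link `g ∈ G = SU(N)` by an element `φ h` of an embedded subgroup
`φ : H = SU(2) → G`, with `h` drawn from the law `∝ w(φ h · g) η(dh)` (`η` = Haar of `H`, `w` the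
one-link Boltzmann weight).  The cosets `φ(H) g` have no measurable section in general, so the
product-space reduction does not apply; the group structure does the work instead.

## Content (`G`, `H` measurable groups; `μ` on `G` LEFT-invariant; `η` on `H` finite, RIGHT- and
INVERSION-invariant — all automatic for Haar on compact groups, `CompactHaar.lean`;
`φ : H →* G` measurable; weight `w : G → ℝ≥0∞` measurable)

* `subgroupMove η φ` — the proposal kernel `g ↦ law of φ h · g`, `h ∼ η`; `lintegral_subgroupMove`.
* `subgroupNorm η φ w g = Z(g) = ∫ w(φ h · g) η(dh)`; `subgroupNorm_translate` — `Z(φ k · g) = Z(g)`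
  (right invariance of `η`): the normaliser is a class function of the coset.
* `subgroupHaarHeatBath η φ w` — the heat-bath kernel `K(g, B) = Z(g)⁻¹ ∫ 1_B(φ h g) w(φ h g) η(dh)`
  (`Kernel.withDensity` of the proposal); `subgroupHaarHeatBath_apply`.
* `subgroupFlow_symm` — the flow `∫_A K(g, B) w(g) μ(dg)` written as a double integral is
  symmetric in `A, B` (substitute `g ↦ (φ h)⁻¹ g` by left invariance of `μ`, then `h ↦ h⁻¹`).
* **`subgroupHaarHeatBath_isReversible`** — `K` is reversible for `w · μ` (`Kernel.IsReversible`);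
  `isMarkovKernel_subgroupHaarHeatBath` when `0 < Z < ∞`; **`subgroupHaarHeatBath_invariant`**.

Dictionary: `G = SU(N)` one link (rest frozen, `FibreLift.lean`), `μ` = Haar, `w(g) =
e^{(β/N) Re tr (g R)}`, `H = SU(2)`, `φ` = the `(i, j)` block embedding, `η` = Haar of SU(2);
`CabibboMarinari.lean` shows the induced law on the subgroup is the `N = 2` link law with staple
`k ŝ` = the quaternionic projection of the `(i, j)` block of `g R`.  Not here: how that SU(2) law is
SAMPLED (Kennedy–Pendleton / Creutz: `RejectionSampling.lean` + the untyped a₀ marginal),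
ergodicity of the sweep over subgroups.
-/

namespace Summit.Ventures.LatticeQCDFlow.Exactness

open MeasureTheory ProbabilityTheory
open scoped ENNReal

variable {G H : Type*} [Group G] [MeasurableSpace G] [MeasurableMul₂ G]
  [Group H] [MeasurableSpace H]
  (η : Measure H) [IsFiniteMeasure η] (φ : H →* G)

/-! ## §1 The proposal: left translation by an `η`-distributed subgroup element -/

omit [MeasurableMul₂ G] in
/-- Measurability of the action map `(g, h) ↦ φ h · g`. -/
theorem measurable_subgroupAct [MeasurableMul₂ G] (hφ : Measurable φ) :
    Measurable fun p : G × H => φ p.2 * p.1 :=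
  (hφ.comp measurable_snd).mul measurable_fst

/-- The proposal kernel: from `g`, move to `φ h · g` with `h ∼ η`. -/
noncomputable def subgroupMove (hφ : Measurable φ) : Kernel G G where
  toFun g := η.map fun h => φ h * g
  measurable' := by
    refine Measure.measurable_of_measurable_coe _ fun s hs => ?_
    have hT : MeasurableSet {p : G × H | φ p.2 * p.1 ∈ s} := measurable_subgroupAct φ hφ hs
    have h_eq : (fun g : G => (η.map fun h => φ h * g) s)
        = fun g => η (Prod.mk g ⁻¹' {p : G × H | φ p.2 * p.1 ∈ s}) := by
      funext g
      rw [Measure.map_apply (hφ.mul_const g) hs]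
      rfl
    rw [h_eq]
    exact measurable_measure_prodMk_left hT

/-- Pointwise: `subgroupMove η φ g = η.map (h ↦ φ h · g)`. -/
theorem subgroupMove_apply (hφ : Measurable φ) (g : G) :
    subgroupMove η φ hφ g = η.map fun h => φ h * g := rfl

/-- Integration against the proposal: `∫ f d(subgroupMove g) = ∫ f(φ h · g) η(dh)`. -/
theorem lintegral_subgroupMove (hφ : Measurable φ) (g : G) {f : G → ℝ≥0∞} (hf : Measurable f) :
    ∫⁻ x, f x ∂(subgroupMove η φ hφ g) = ∫⁻ h, f (φ h * g) ∂η := by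
  rw [subgroupMove_apply, lintegral_map hf (hφ.mul_const g)]

/-- The proposal is a finite kernel when `η` is finite (Haar probability of a compact subgroup). -/
instance isFiniteKernel_subgroupMove (hφ : Measurable φ) :
    IsFiniteKernel (subgroupMove η φ hφ) := by
  refine ⟨⟨η Set.univ, measure_lt_top η _, fun g => le_of_eq ?_⟩⟩
  rw [subgroupMove_apply, Measure.map_apply (hφ.mul_const g) MeasurableSet.univ, Set.preimage_univ]

/-! ## §2 The normaliser is a class function of the coset -/

/-- The conditional normaliser `Z(g) = ∫ w(φ h · g) η(dh)`. -/
noncomputable def subgroupNorm (w : G → ℝ≥0∞) (g : G) : ℝ≥0∞ := ∫⁻ h, w (φ h * g) ∂η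

/-- Measurability of the normaliser. -/
theorem measurable_subgroupNorm (hφ : Measurable φ) {w : G → ℝ≥0∞} (hw : Measurable w) :
    Measurable (subgroupNorm η φ w) :=
  (hw.comp (measurable_subgroupAct φ hφ)).lintegral_prod_right'

omit [IsFiniteMeasure η] [MeasurableMul₂ G] [MeasurableSpace G] in
/-- `Z` is constant on cosets: `Z(φ k · g) = Z(g)` (right invariance of `η`). -/
theorem subgroupNorm_translate [MeasurableMul H] [η.IsMulRightInvariant] (w : G → ℝ≥0∞)
    (k : H) (g : G) : subgroupNorm η φ w (φ k * g) = subgroupNorm η φ w g := by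
  unfold subgroupNorm
  have h := lintegral_mul_right_eq_self (μ := η) (fun h => w (φ h * g)) k
  simp only [map_mul, mul_assoc] at h
  exact h

/-! ## §3 The heat-bath kernel -/

/-- **The subgroup heat bath**: left-multiply `g` by `φ h`, `h` drawn with density
`w(φ h · g) / Z(g)` against `η`. -/
noncomputable def subgroupHaarHeatBath (hφ : Measurable φ) (w : G → ℝ≥0∞) : Kernel G G :=
  Kernel.withDensity (subgroupMove η φ hφ) fun g g' => w g' * (subgroupNorm η φ w g)⁻¹

/-- Measurability of the heat-bath density `(g, g') ↦ w(g') / Z(g)`. -/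
theorem measurable_subgroupHaarHeatBathDensity (hφ : Measurable φ) {w : G → ℝ≥0∞} (hw : Measurable w) :
    Measurable (Function.uncurry fun (g : G) (g' : G) => w g' * (subgroupNorm η φ w g)⁻¹) :=
  (hw.comp measurable_snd).mul ((measurable_subgroupNorm η φ hφ hw).comp measurable_fst).inv

/-- Set-wise formula: `K(g, B) = ∫ 1_B(φ h g) · w(φ h g) · Z(g)⁻¹ η(dh)`. -/
theorem subgroupHaarHeatBath_apply (hφ : Measurable φ) {w : G → ℝ≥0∞}
    (hw : Measurable w) (g : G) {B : Set G} (hB : MeasurableSet B) :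
    subgroupHaarHeatBath η φ hφ w g B
      = ∫⁻ h, B.indicator 1 (φ h * g) * w (φ h * g) * (subgroupNorm η φ w g)⁻¹ ∂η := by
  rw [subgroupHaarHeatBath, Kernel.withDensity_apply' _ (measurable_subgroupHaarHeatBathDensity η φ hφ hw),
    ← lintegral_indicator hB,
    lintegral_subgroupMove η φ hφ g ((hw.mul_const _).indicator hB)]
  refine lintegral_congr fun h => ?_
  by_cases hmem : φ h * g ∈ B
  · rw [Set.indicator_of_mem hmem, Set.indicator_of_mem hmem, Pi.one_apply, one_mul]
  · rw [Set.indicator_of_notMem hmem, Set.indicator_of_notMem hmem, zero_mul, zero_mul]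

/-- The heat bath is an s-finite kernel when `w < ∞` and no normaliser vanishes. -/
theorem isSFiniteKernel_subgroupHaarHeatBath (hφ : Measurable φ) {w : G → ℝ≥0∞}
    (hw_top : ∀ g, w g ≠ ∞) (hZ : ∀ g, subgroupNorm η φ w g ≠ 0) :
    IsSFiniteKernel (subgroupHaarHeatBath η φ hφ w) :=
  Kernel.IsSFiniteKernel.withDensity _
    fun g g' => ENNReal.mul_ne_top (hw_top g') (ENNReal.inv_ne_top.mpr (hZ g))

/-- The heat bath is a Markov kernel when every normaliser is finite and non-zero. -/
theorem isMarkovKernel_subgroupHaarHeatBath (hφ : Measurable φ) {w : G → ℝ≥0∞}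
    (hw : Measurable w) (hZ : ∀ g, subgroupNorm η φ w g ≠ 0) (hZtop : ∀ g, subgroupNorm η φ w g ≠ ∞) :
    IsMarkovKernel (subgroupHaarHeatBath η φ hφ w) := by
  refine ⟨fun g => ⟨?_⟩⟩
  rw [subgroupHaarHeatBath_apply η φ hφ hw g MeasurableSet.univ]
  simp only [Set.indicator_univ, Pi.one_apply, one_mul]
  have hm : Measurable fun h => w (φ h * g) := hw.comp (hφ.mul_const g)
  calc ∫⁻ h, w (φ h * g) * (subgroupNorm η φ w g)⁻¹ ∂η
      = (∫⁻ h, w (φ h * g) ∂η) * (subgroupNorm η φ w g)⁻¹ := lintegral_mul_const _ hm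
    _ = 1 := ENNReal.mul_inv_cancel (hZ g) (hZtop g)

/-! ## §4 Reversibility -/

/-- The integrand of the flow double integral is jointly measurable. -/
theorem measurable_subgroupFlowIntegrand (hφ : Measurable φ) {w : G → ℝ≥0∞} (hw : Measurable w)
    {A B : Set G}
    (hA : MeasurableSet A) (hB : MeasurableSet B) :
    Measurable (Function.uncurry fun (g : G) (h : H) =>
      A.indicator 1 g * B.indicator 1 (φ h * g) * w g * w (φ h * g) * (subgroupNorm η φ w g)⁻¹) :=
  (((((measurable_one.indicator hA).comp measurable_fst).mul
    ((measurable_one.indicator hB).comp (measurable_subgroupAct φ hφ))).mul (hw.comp measurable_fst)).mul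
    (hw.comp (measurable_subgroupAct φ hφ))).mul
    ((measurable_subgroupNorm η φ hφ hw).comp measurable_fst).inv

/-- The probability flow `A → B` of the heat bath under `w · μ`, as a double integral. -/
theorem subgroupFlow_eq (hφ : Measurable φ) (μ : Measure G) {w : G → ℝ≥0∞}
    (hw : Measurable w) {A B : Set G} (hA : MeasurableSet A) (hB : MeasurableSet B) :
    ∫⁻ g in A, subgroupHaarHeatBath η φ hφ w g B ∂(μ.withDensity w)
      = ∫⁻ g, ∫⁻ h, A.indicator 1 g * B.indicator 1 (φ h * g) * w g * w (φ h * g)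
          * (subgroupNorm η φ w g)⁻¹ ∂η ∂μ := by
  rw [setLIntegral_withDensity_eq_setLIntegral_mul μ hw (Kernel.measurable_coe _ hB) hA,
    ← lintegral_indicator hA]
  refine lintegral_congr fun g => ?_
  have hmeas : Measurable fun h => B.indicator 1 (φ h * g) * w (φ h * g)
      * (subgroupNorm η φ w g)⁻¹ :=
    ((((measurable_one.indicator hB).comp (hφ.mul_const g))).mul (hw.comp (hφ.mul_const g))).mul
      measurable_const
  by_cases hg : g ∈ A
  · rw [Set.indicator_of_mem hg, Pi.mul_apply, subgroupHaarHeatBath_apply η φ hφ hw g hB,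
      ← lintegral_const_mul _ hmeas]
    refine lintegral_congr fun h => ?_
    rw [Set.indicator_of_mem hg, Pi.one_apply]
    ring
  · rw [Set.indicator_of_notMem hg]
    simp only [Set.indicator_of_notMem hg, zero_mul, lintegral_const]

/-- **Symmetry of the flow.**  With `μ` left-invariant and `η` right- and inversion-invariant, the
double integral of `subgroupFlow_eq` is symmetric under `A ↔ B`: substitute `g ↦ (φ h)⁻¹ g`
(left invariance of `μ`; the normaliser is a class function), then `h ↦ h⁻¹`. -/
theorem subgroupFlow_symm (hφ : Measurable φ) (μ : Measure G) [SFinite μ] [μ.IsMulLeftInvariant]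
    [MeasurableInv H] [MeasurableMul H] [η.IsMulRightInvariant] [η.IsInvInvariant] {w : G → ℝ≥0∞}
    (hw : Measurable w) {A B : Set G} (hA : MeasurableSet A) (hB : MeasurableSet B) :
    ∫⁻ g, ∫⁻ h, A.indicator 1 g * B.indicator 1 (φ h * g) * w g * w (φ h * g)
          * (subgroupNorm η φ w g)⁻¹ ∂η ∂μ
      = ∫⁻ g, ∫⁻ h, B.indicator 1 g * A.indicator 1 (φ h * g) * w g * w (φ h * g)
          * (subgroupNorm η φ w g)⁻¹ ∂η ∂μ := by
  rw [lintegral_lintegral_swap ((measurable_subgroupFlowIntegrand η φ hφ hw hA hB).aemeasurable),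
    lintegral_lintegral_swap ((measurable_subgroupFlowIntegrand η φ hφ hw hB hA).aemeasurable)]
  -- the inner integral after the substitution g ↦ (φ h)⁻¹ g
  set F : H → ℝ≥0∞ := fun k => ∫⁻ x, A.indicator 1 (φ k * x) * B.indicator 1 x * w (φ k * x) * w x
      * (subgroupNorm η φ w x)⁻¹ ∂μ with hF
  have hsub : ∀ h : H, ∫⁻ g, A.indicator 1 g * B.indicator 1 (φ h * g) * w g * w (φ h * g)
        * (subgroupNorm η φ w g)⁻¹ ∂μ = F h⁻¹ := by
    intro h
    have key := lintegral_mul_left_eq_self (μ := μ)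
      (fun x => A.indicator 1 (φ h⁻¹ * x) * B.indicator 1 x * w (φ h⁻¹ * x) * w x
        * (subgroupNorm η φ w x)⁻¹) (φ h)
    refine Eq.trans (lintegral_congr fun g => ?_) key
    simp only [map_inv, inv_mul_cancel_left, subgroupNorm_translate η φ w h g]
  simp_rw [hsub]
  rw [lintegral_inv_eq_self (μ := η) F]
  refine lintegral_congr fun h => ?_
  simp only [hF]
  refine lintegral_congr fun x => ?_
  ring

/-- **The subgroup heat bath is reversible** for `w · μ`: for every `μ` left-invariant, `η`
finite, right- and inversion-invariant (Haar on a compact subgroup), every measurable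
homomorphism `φ` and every measurable weight `w`. -/
theorem subgroupHaarHeatBath_isReversible (hφ : Measurable φ) (μ : Measure G)
    [SFinite μ] [μ.IsMulLeftInvariant] [MeasurableInv H] [MeasurableMul H] [η.IsMulRightInvariant]
    [η.IsInvInvariant] {w : G → ℝ≥0∞} (hw : Measurable w) :
    Kernel.IsReversible (subgroupHaarHeatBath η φ hφ w) (μ.withDensity w) := by
  intro A B hA hB
  rw [subgroupFlow_eq η φ hφ μ hw hA hB, subgroupFlow_eq η φ hφ μ hw hB hA]
  exact subgroupFlow_symm η φ hφ μ hw hA hB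

/-- … hence `w · μ` is invariant when the heat bath is a Markov kernel (`0 < Z < ∞`). -/
theorem subgroupHaarHeatBath_invariant (hφ : Measurable φ) (μ : Measure G)
    [SFinite μ] [μ.IsMulLeftInvariant] [MeasurableInv H] [MeasurableMul H] [η.IsMulRightInvariant]
    [η.IsInvInvariant] {w : G → ℝ≥0∞} (hw : Measurable w) (hZ : ∀ g, subgroupNorm η φ w g ≠ 0)
    (hZtop : ∀ g, subgroupNorm η φ w g ≠ ∞) :
    Kernel.Invariant (subgroupHaarHeatBath η φ hφ w) (μ.withDensity w) := by
  haveI := isMarkovKernel_subgroupHaarHeatBath η φ hφ hw hZ hZtop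
  exact (subgroupHaarHeatBath_isReversible η φ hφ μ hw).invariant

end Summit.Ventures.LatticeQCDFlow.Exactness
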